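import Summits.ResolutionOfSingularities.ResolutionOfSingularities.Theorems.FrobeniusLadderFInjectiveMacaulayficationCIConeFiModelCore
import Summits.ResolutionOfSingularities.ResolutionOfSingularities.Theorems.FrobeniusLadderFInjectiveMacaulayficationCIChartPresentationBridge
import Summits.ResolutionOfSingularities.ResolutionOfSingularities.Theorems.FrobeniusLadderFInjectiveMacaulayficationDegreeZeroDescentLocal
import HarnessLib

/-!
# G5ᶜⁱ — THE CI-CN ENGINE IN GLOBAL FORM: the monomial blow-up of a complete intersection from naive-chart certificates
# (crux `FInjectiveMacaulayfication`, CI-CN engine glue; seat res-L1-w45a-stub-1)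

[OURS · L1 W4.5a] Support file for crux stmt-ResolutionOfSingularities-15315. AI-written, weaker than expert review; no statement of
[claim: Hironaka2017] is used. `X = V(F₁, …, F_r) ⊆ 𝔸ⁿ` integral (`(F)` prime, no `x̄ⱼ = 0`), `I_A` a monomial ideal supported on
the coordinate stratum `V(X_J)` (every exponent involves a `J`-variable; a pure power of every `J`-variable) with vertex charts `x^(m_c)`
(cover identities); the model is the blow-up of `I_A·R`, `R = k[X]/(F)` (CLOSED CENTRE `V(X_J) ∩ X`; strat-1 (β₄) shape),
i.e. the strict transform of `X` under the toric modification of `𝔸ⁿ`. Its `x̄^(m_c)`-chart is `B_c = R[I_A R/x̄^(m_c)]`, the image of the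
chart map `Ψ : k[Y] → R[1/x̄^(m_c)]` (`CIChartPresentationRange`), with `(g_c) ⊆ ker ⊆ ((g_c) : Y^∞)` for the strict transforms
`θ_c F_l = Y^(d_cl) g_cl` (`CIChartPresentationKernel`).

* `algebraMap_mem_of_pow_mem` — over the centre: if `u ∈ 𝔔` (a prime of `R[I/u]`) and `x^N ∈ I` then `x ∈ 𝔔`.
* `chartClause_of_quotientChartClause` — THE PER-CHART TRANSPORT: the Cohen–Macaulay + Frobenius-closed clause at every maximal
  `𝔔 ∋ x̄^(m_c)` of `B_c` follows from, at every maximal `Q'` of the NAIVE chart quotient `k[Y]/(g_c)` containing `θ_c(X_j)`, `j ∈ J`: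
  (i) the variables in `Q'` are non-zero-divisors on `k[Y]_(Q') ⧸ (g_c)` (ORBIT expected dimension — `CIChartPresentationLocal`,
  res-L1-w45a-stub-6's `CIOrbitExpectedDim` on smooth charts) and (ii) the clause for `(k[Y]/(g_c))_(Q')` (stub-6's
  `CIChartClause.ciChartClause` = Fedder route, or `CIJacobian`/`CISmoothChart` = Jacobian route). Route-agnostic: both (i) and (ii)
  are ONE hypothesis `hon'`. Transport by `CIChartPresentationBridge.nonempty_localization_ringEquiv_quotientChart` +
  `DegreeZeroDescent.inlineClause_of_ringEquiv`.
* `ciConeFiModelRel` — G5ᶜⁱ (closed-centre / relative form): `CIConeFiModelCore.ciConeFiModelRel_of_chartClause` with `hon` discharged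
  chart by chart. The point-centred form (pure powers of EVERY variable) is deliberately not stated: it has no instance on key
  re-embedded complete intersections (res-L1-w45a-idea-1 06:11:14Z, tri-1 F27); here pure powers are asked on `J` only, the chart binder
  at the `Q'` containing `θ_c(X_j)` for `j ∈ J`, and hoff off `V(X_J)`.
No definitions, no named facts. [folklore]
-/

set_option linter.dupNamespace false

noncomputable section

open AlgebraicGeometry CategoryTheory Literature.AlgebraicGeometry.Resolution MvPolynomial

namespace Summit.ResolutionOfSingularities.ResolutionOfSingularities.Theorems.FInjectiveMacaulayfication.CIConeFiModel

open Summit.ResolutionOfSingularities.ResolutionOfSingularities.Theorems.FInjectiveMacaulayfication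

/-- **Over the centre.** In an affine blow-up algebra `R[I/u]`, if a prime `𝔔` contains `u` and `x^N ∈ I`, then `x ∈ 𝔔`
(`x^N = (x^N/u)·u`). [folklore] -/
theorem algebraMap_mem_of_pow_mem {R : Type} [CommRing R] (I : Ideal R) (u : R) (𝔔 : Ideal ↥(blowupAlgebra I u)) [𝔔.IsPrime]
    (hu : algebraMap R ↥(blowupAlgebra I u) u ∈ 𝔔) {x : R} {N : ℕ} (hx : x ^ N ∈ I) :
    algebraMap R ↥(blowupAlgebra I u) x ∈ 𝔔 := by
  refine Ideal.IsPrime.mem_of_pow_mem ‹_› N ?_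
  have h : algebraMap R ↥(blowupAlgebra I u) x ^ N =
      ⟨algebraMap R (Localization.Away u) (x ^ N) * IsLocalization.Away.invSelf u, div_mem_blowupAlgebra I u hx⟩ *
        algebraMap R ↥(blowupAlgebra I u) u := by
    apply Subtype.ext
    change (algebraMap R (Localization.Away u) x) ^ N =
      algebraMap R (Localization.Away u) (x ^ N) * IsLocalization.Away.invSelf u * algebraMap R (Localization.Away u) u
    rw [map_pow, mul_assoc, mul_comm (IsLocalization.Away.invSelf u), IsLocalization.Away.mul_invSelf, mul_one]
  rw [h]
  exact Ideal.mul_mem_left _ _ hu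

section Chart

variable (p : ℕ) {n : ℕ} {k : Type} [Field k]
  (V : Matrix (Fin n) (Fin n) ℕ)
  (hV : IsUnit (V.map (Nat.cast : ℕ → ℤ)).det) (m : Fin n →₀ ℕ) (a : Fin n → (Fin n →₀ ℕ))
  (hgen : ∀ i : Fin n, (Finsupp.equivFunOnFinite.symm (V.mulVec ⇑(a i)) : Fin n →₀ ℕ) =
    Finsupp.equivFunOnFinite.symm (V.mulVec ⇑m) + Finsupp.single i 1)
  (A : Finset (Fin n →₀ ℕ)) (haA : ∀ i, a i ∈ A)
  (hge : ∀ e ∈ A, (Finsupp.equivFunOnFinite.symm (V.mulVec ⇑m) : Fin n →₀ ℕ) ≤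
    Finsupp.equivFunOnFinite.symm (V.mulVec ⇑e))
  (J : Finset (Fin n)) (hprim : ∀ j ∈ J, ∃ N : ℕ, Finsupp.single j N ∈ A)
  {r : ℕ} (Fs gs : Fin r → MvPolynomial (Fin n) k) (d : Fin r → (Fin n →₀ ℕ))
  (hθF : ∀ l : Fin r, aeval (fun j : Fin n => ∏ l : Fin n, (X l : MvPolynomial (Fin n) k) ^ V l j) (Fs l) =
    monomial (d l) (1 : k) * gs l)
  (hunit : ∀ l : Fin r, ∃ (N : ℕ) (r' : Fin n →₀ ℕ), N • m = ∑ j : Fin n, d l j • a j + r')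

include hV hgen haA hge hprim hθF hunit in
/-- **THE PER-CHART TRANSPORT (G5ᶜⁱ, chart step).** See the module docstring: the clause at a maximal `𝔔 ∋ x̄^m` of the
strict-transform chart `B = R[I_A R/x̄^m]` from the binder-and-clause hypothesis `hon'` at the corresponding maximal ideal `Q'` of the
naive quotient `k[Y]/(g)` (which contains `θ(X_j)` for `j ∈ J` because `x̄ⱼ^N/x̄^m ∈ B` and `x̄^m ∈ 𝔔`). [folklore] -/
theorem chartClause_of_quotientChartClause
    (hon' : ∀ (Q' : Ideal (MvPolynomial (Fin n) k ⧸ Ideal.span (Set.range gs))) [Q'.IsMaximal],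
      (∀ j ∈ J, Ideal.Quotient.mk (Ideal.span (Set.range gs)) (aeval (fun j : Fin n => ∏ l : Fin n, (X l : MvPolynomial (Fin n) k) ^ V l j) (X j : MvPolynomial (Fin n) k)) ∈ Q') →
        (∀ i : Fin n, (X i : MvPolynomial (Fin n) k) ∈ Q'.comap (Ideal.Quotient.mk (Ideal.span (Set.range gs))) →
          IsSMulRegular (Localization.AtPrime (Q'.comap (Ideal.Quotient.mk (Ideal.span (Set.range gs)))) ⧸
              (Ideal.span (Set.range gs)).map (algebraMap (MvPolynomial (Fin n) k)
                (Localization.AtPrime (Q'.comap (Ideal.Quotient.mk (Ideal.span (Set.range gs)))))))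
            (algebraMap (MvPolynomial (Fin n) k) (Localization.AtPrime (Q'.comap (Ideal.Quotient.mk (Ideal.span (Set.range gs))))) (X i))) ∧
        ∀ dd : ℕ, ringKrullDim (Localization.AtPrime Q') = dd → ∀ s : Fin dd → Localization.AtPrime Q',
          (Ideal.span (Set.range s)).radical.IsMaximal →
            RingTheory.Sequence.IsWeaklyRegular (Localization.AtPrime Q') (List.ofFn s) ∧
            ∀ y : Localization.AtPrime Q', (∃ e : ℕ, y ^ p ^ e ∈ Ideal.span
              ((fun z : Localization.AtPrime Q' => z ^ p ^ e) ''
                (Ideal.span (Set.range s) : Set (Localization.AtPrime Q')))) → y ∈ Ideal.span (Set.range s))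
    (𝔔 : Ideal ↥(blowupAlgebra (Ideal.span ((fun e : Fin n →₀ ℕ => Ideal.Quotient.mk (Ideal.span (Set.range Fs)) (monomial e (1 : k))) '' (A : Set _))) (Ideal.Quotient.mk (Ideal.span (Set.range Fs)) (monomial m (1 : k))))) [𝔔.IsMaximal]
    (hu : algebraMap (MvPolynomial (Fin n) k ⧸ Ideal.span (Set.range Fs)) ↥(blowupAlgebra (Ideal.span ((fun e : Fin n →₀ ℕ => Ideal.Quotient.mk (Ideal.span (Set.range Fs)) (monomial e (1 : k))) '' (A : Set _))) (Ideal.Quotient.mk (Ideal.span (Set.range Fs)) (monomial m (1 : k)))) (Ideal.Quotient.mk (Ideal.span (Set.range Fs)) (monomial m (1 : k))) ∈ 𝔔) :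
    ∀ dd : ℕ, ringKrullDim (Localization.AtPrime 𝔔) = dd → ∀ s : Fin dd → Localization.AtPrime 𝔔,
      (Ideal.span (Set.range s)).radical.IsMaximal →
        RingTheory.Sequence.IsWeaklyRegular (Localization.AtPrime 𝔔) (List.ofFn s) ∧
        ∀ y : Localization.AtPrime 𝔔, (∃ e : ℕ, y ^ p ^ e ∈ Ideal.span
          ((fun z : Localization.AtPrime 𝔔 => z ^ p ^ e) ''
            (Ideal.span (Set.range s) : Set (Localization.AtPrime 𝔔)))) → y ∈ Ideal.span (Set.range s) := by
  classical
  -- the corestriction `φ` of the chart map and its kernel sandwich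
  have hex := CIChartPresentationLocal.exists_corestriction V hV m a hgen A haA hge Fs
  let φ := hex.choose
  have hsurj : Function.Surjective φ := hex.choose_spec.1
  have hφ : ∀ q : MvPolynomial (Fin n) k, (φ q).val = aeval (fun i : Fin n => algebraMap (MvPolynomial (Fin n) k ⧸ Ideal.span (Set.range Fs))
          (Localization.Away (Ideal.Quotient.mk (Ideal.span (Set.range Fs)) (monomial m (1 : k))))
          (Ideal.Quotient.mk (Ideal.span (Set.range Fs)) (monomial (a i) (1 : k))) *
          IsLocalization.Away.invSelf (Ideal.Quotient.mk (Ideal.span (Set.range Fs)) (monomial m (1 : k)))) q := hex.choose_spec.2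
  have hker : ∀ h : MvPolynomial (Fin n) k, h ∈ RingHom.ker φ ↔ aeval (fun i : Fin n => algebraMap (MvPolynomial (Fin n) k ⧸ Ideal.span (Set.range Fs))
          (Localization.Away (Ideal.Quotient.mk (Ideal.span (Set.range Fs)) (monomial m (1 : k))))
          (Ideal.Quotient.mk (Ideal.span (Set.range Fs)) (monomial (a i) (1 : k))) *
          IsLocalization.Away.invSelf (Ideal.Quotient.mk (Ideal.span (Set.range Fs)) (monomial m (1 : k)))) h = 0 := fun h => by
    rw [RingHom.mem_ker, Subtype.ext_iff, hφ]
    rfl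
  have hks := CIChartPresentationLocal.span_le_ker_and_sat V hV m a hgen Fs gs d hθF hunit φ hker
  -- the maximal ideal `Q'` of `k[Y]/(g)` under `𝔔`
  have hex' := CIChartPresentationBridge.exists_isMaximal_comap_eq φ hsurj (Ideal.span (Set.range gs)) hks.1 𝔔
  let Q' := hex'.choose
  haveI hQ'max : Q'.IsMaximal := hex'.choose_spec.1
  have hQ' : Q'.comap (Ideal.Quotient.mk (Ideal.span (Set.range gs))) = 𝔔.comap φ := hex'.choose_spec.2
  -- every `θ(X_j)` lies in `Q'`: `φ (θ X_j) = x̄ⱼ/1` and `x̄ⱼ^N ∈ I_A·R`, `x̄^m ∈ 𝔔`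
  have hθQ' : ∀ j ∈ J, Ideal.Quotient.mk (Ideal.span (Set.range gs)) (aeval (fun j : Fin n => ∏ l : Fin n, (X l : MvPolynomial (Fin n) k) ^ V l j) (X j : MvPolynomial (Fin n) k)) ∈ Q' := by
    intro j hjJ
    have hj : aeval (fun j : Fin n => ∏ l : Fin n, (X l : MvPolynomial (Fin n) k) ^ V l j) (X j : MvPolynomial (Fin n) k) ∈ Q'.comap (Ideal.Quotient.mk (Ideal.span (Set.range gs))) := by
      rw [hQ', Ideal.mem_comap]
      have hN := (hprim j hjJ).choose_spec
      have hval : φ (aeval (fun j : Fin n => ∏ l : Fin n, (X l : MvPolynomial (Fin n) k) ^ V l j) (X j : MvPolynomial (Fin n) k)) = algebraMap (MvPolynomial (Fin n) k ⧸ Ideal.span (Set.range Fs)) ↥(blowupAlgebra (Ideal.span ((fun e : Fin n →₀ ℕ => Ideal.Quotient.mk (Ideal.span (Set.range Fs)) (monomial e (1 : k))) '' (A : Set _))) (Ideal.Quotient.mk (Ideal.span (Set.range Fs)) (monomial m (1 : k)))) (Ideal.Quotient.mk (Ideal.span (Set.range Fs)) (X j)) := by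
        apply Subtype.ext
        rw [hφ, CIChartPresentationRange.psi_theta (Ideal.span (Set.range Fs)) V hV m a hgen (X j)]
        rfl
      rw [hval]
      refine algebraMap_mem_of_pow_mem _ _ 𝔔 hu (N := (hprim j hjJ).choose) ?_
      rw [← map_pow, X_pow_eq_monomial]
      exact Ideal.subset_span ⟨_, hN, rfl⟩
    exact hj
  -- binder and clause at `Q'`, then transport along `B_𝔔 ≃ (k[Y]/(g))_(Q')`
  have hX := (hon' Q' hθQ').1
  have hcl := (hon' Q' hθQ').2
  have hε := CIChartPresentationBridge.nonempty_localization_ringEquiv_quotientChart V hV m a hgen A Fs gs d hθF hunit φ hsurj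
    hφ 𝔔 Q' hQ' hX
  exact DegreeZeroDescent.inlineClause_of_ringEquiv p (L := Localization.AtPrime Q') (L' := Localization.AtPrime 𝔔)
    hε.some.symm hcl

end Chart

/-! ## G5ᶜⁱ -/

/-- **G5ᶜⁱ `ciConeFiModelRel` — THE CI-CN ENGINE, GLOBAL (CLOSED-CENTRE) FORM.** For an integral complete intersection
`X = V(F₁, …, F_r) ⊆ 𝔸ⁿ` (`(F)` prime, no `x̄ⱼ = 0`) satisfying the clause off `V(X_J)`, a monomial centre `I_A` supported on `V(X_J)`
(every exponent involves a `J`-variable; a pure power of every `J`-variable in `A`) with vertex and per-chart toric data (`V_c` unimodular, `a_c`, strict transforms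
`θ_c F_l = Y^(d_cl) g_cl`, `hunit`), IF at every maximal ideal `Q'` of every naive chart quotient `k[Y]/(g_c)` lying over `V(X_J)` the orbit binder (variables in
`Q'` regular modulo `(g_c)` locally) and the Cohen–Macaulay + Frobenius-closed clause hold, THEN the blow-up of `I_A·R` is an F-injective
Macaulayfication of `Spec k[X]/(F)`: proper, birational, every stalk a domain satisfying the crux clause. [folklore] -/
theorem ciConeFiModelRel (p : ℕ) [Fact p.Prime] (k : Type) [Field k] [CharP k p] (n : ℕ) (J : Finset (Fin n))
    (A : Finset (Fin n →₀ ℕ)) (hAJ : ∀ a ∈ A, ∃ j ∈ J, 0 < a j) (hprim : ∀ j ∈ J, ∃ N : ℕ, Finsupp.single j N ∈ A)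
    (t : ℕ) (ht : 0 < t) (m : Fin t → (Fin n →₀ ℕ)) (hm : ∀ c : Fin t, m c ∈ A)
    (hcov : ∀ a ∈ A, ∃ (c : Fin t) (K : ℕ), 1 ≤ K ∧ ∃ y ∈ (Ideal.span ((fun b : Fin n →₀ ℕ => (MvPolynomial.monomial b (1 : k) : MvPolynomial (Fin n) k)) '' (A : Set (Fin n →₀ ℕ)))) ^ (K - 1),
      (MvPolynomial.monomial a (1 : k) : MvPolynomial (Fin n) k) ^ K = MvPolynomial.monomial (m c) 1 * y)
    (V : Fin t → Matrix (Fin n) (Fin n) ℕ) (hV : ∀ c, IsUnit ((V c).map (Nat.cast : ℕ → ℤ)).det)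
    (a : Fin t → Fin n → (Fin n →₀ ℕ)) (haA : ∀ c i, a c i ∈ A)
    (hgen : ∀ (c : Fin t) (i : Fin n), (Finsupp.equivFunOnFinite.symm ((V c).mulVec ⇑(a c i)) : Fin n →₀ ℕ) =
      Finsupp.equivFunOnFinite.symm ((V c).mulVec ⇑(m c)) + Finsupp.single i 1)
    (hge : ∀ (c : Fin t), ∀ e ∈ A, (Finsupp.equivFunOnFinite.symm ((V c).mulVec ⇑(m c)) : Fin n →₀ ℕ) ≤
      Finsupp.equivFunOnFinite.symm ((V c).mulVec ⇑e))
    {r : ℕ} (Fs : Fin r → MvPolynomial (Fin n) k) (hprime : (Ideal.span (Set.range Fs)).IsPrime)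
    (hXne : ∀ v : Fin n, Ideal.Quotient.mk (Ideal.span (Set.range Fs)) (MvPolynomial.X v) ≠ 0)
    (hoff : ∀ (Q : Ideal (MvPolynomial (Fin n) k ⧸ Ideal.span (Set.range Fs))) [Q.IsMaximal],
      (∃ j ∈ J, Ideal.Quotient.mk (Ideal.span (Set.range Fs)) (MvPolynomial.X j) ∉ Q) →
      ∀ dd : ℕ, ringKrullDim (Localization.AtPrime Q) = dd → ∀ s : Fin dd → Localization.AtPrime Q,
        (Ideal.span (Set.range s)).radical.IsMaximal →
          RingTheory.Sequence.IsWeaklyRegular (Localization.AtPrime Q) (List.ofFn s) ∧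
          ∀ y : Localization.AtPrime Q, (∃ e : ℕ, y ^ p ^ e ∈ Ideal.span
            ((fun z : Localization.AtPrime Q => z ^ p ^ e) ''
              (Ideal.span (Set.range s) : Set (Localization.AtPrime Q)))) → y ∈ Ideal.span (Set.range s))
    (gs : Fin t → Fin r → MvPolynomial (Fin n) k) (d : Fin t → Fin r → (Fin n →₀ ℕ))
    (hθF : ∀ (c : Fin t) (l : Fin r), aeval (fun j : Fin n => ∏ i : Fin n, (X i : MvPolynomial (Fin n) k) ^ V c i j) (Fs l) =
      monomial (d c l) (1 : k) * gs c l)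
    (hunit : ∀ (c : Fin t) (l : Fin r), ∃ (N : ℕ) (r' : Fin n →₀ ℕ), N • m c = ∑ j : Fin n, d c l j • a c j + r')
    (hon' : ∀ (c : Fin t) (Q' : Ideal (MvPolynomial (Fin n) k ⧸ Ideal.span (Set.range (gs c)))) [Q'.IsMaximal],
      (∀ j ∈ J, Ideal.Quotient.mk (Ideal.span (Set.range (gs c)))
        (aeval (fun j : Fin n => ∏ i : Fin n, (X i : MvPolynomial (Fin n) k) ^ V c i j) (X j : MvPolynomial (Fin n) k)) ∈ Q') →
        (∀ i : Fin n, (X i : MvPolynomial (Fin n) k) ∈ Q'.comap (Ideal.Quotient.mk (Ideal.span (Set.range (gs c)))) →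
          IsSMulRegular (Localization.AtPrime (Q'.comap (Ideal.Quotient.mk (Ideal.span (Set.range (gs c))))) ⧸
              (Ideal.span (Set.range (gs c))).map (algebraMap (MvPolynomial (Fin n) k)
                (Localization.AtPrime (Q'.comap (Ideal.Quotient.mk (Ideal.span (Set.range (gs c))))))))
            (algebraMap (MvPolynomial (Fin n) k)
              (Localization.AtPrime (Q'.comap (Ideal.Quotient.mk (Ideal.span (Set.range (gs c)))))) (X i))) ∧
        ∀ dd : ℕ, ringKrullDim (Localization.AtPrime Q') = dd → ∀ s : Fin dd → Localization.AtPrime Q',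
          (Ideal.span (Set.range s)).radical.IsMaximal →
            RingTheory.Sequence.IsWeaklyRegular (Localization.AtPrime Q') (List.ofFn s) ∧
            ∀ y : Localization.AtPrime Q', (∃ e : ℕ, y ^ p ^ e ∈ Ideal.span
              ((fun z : Localization.AtPrime Q' => z ^ p ^ e) ''
                (Ideal.span (Set.range s) : Set (Localization.AtPrime Q')))) → y ∈ Ideal.span (Set.range s)) :
    ∃ (X' : Scheme.{0}) (π : X' ⟶ Spec (.of (MvPolynomial (Fin n) k ⧸ Ideal.span (Set.range Fs)))), IsProper π ∧
      Literature.AlgebraicGeometry.Resolution.IsBirational π ∧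
      ∀ y : X', IsDomain (X'.presheaf.stalk y) ∧ ∀ dd : ℕ, ringKrullDim (X'.presheaf.stalk y) = dd →
        ∀ s : Fin dd → X'.presheaf.stalk y, (Ideal.span (Set.range s)).radical.IsMaximal →
          RingTheory.Sequence.IsWeaklyRegular (X'.presheaf.stalk y) (List.ofFn s) ∧
          ∀ z : X'.presheaf.stalk y, (∃ e : ℕ, z ^ p ^ e ∈
              Ideal.span ((fun w : X'.presheaf.stalk y => w ^ p ^ e) ''
                (Ideal.span (Set.range s) : Set (X'.presheaf.stalk y)))) →
            z ∈ Ideal.span (Set.range s) :=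
  CIConeFiModelCore.ciConeFiModelRel_of_chartClause p k n J A hAJ t ht m hm hcov (Ideal.span (Set.range Fs)) hprime hXne hoff
    (fun c 𝔔 _ hu => chartClause_of_quotientChartClause p (V c) (hV c) (m c) (a c) (hgen c) A (haA c) (hge c) J hprim Fs (gs c)
      (d c) (hθF c) (hunit c) (hon' c) 𝔔 hu)

end Summit.ResolutionOfSingularities.ResolutionOfSingularities.Theorems.FInjectiveMacaulayfication.CIConeFiModel

end
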